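import Summits.ResolutionOfSingularities.ResolutionOfSingularities.Theses.DefectlessFrames

/-!
# Crux `DefectlessFramesR` (stmt-ResolutionOfSingularities-17921) — the hypothesis `f ≠ 0` is load-bearing

Route `ResolutionOfSingularities/DefectlessFrames`, crux `DefectlessFramesR` (defectless separable
re-framing of hypersurface frames along a rank-one zero-dimensional valuation over a perfect
field).  `defectlessFramesR_false_without_f_ne_zero` proves that the crux with the single
hypothesis `f ≠ 0 →` deleted (everything else verbatim; this is exactly the retired rev-2 crux
`DefectlessFrames`, stmt-ResolutionOfSingularities-19085, whose refutation file
`Theorems/DefectlessFramesDefectlessFramesRefutation.lean` no longer elaborates since its target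
decl left the route file) is FALSE.

Witness: `p = 2`, `k = 𝔽₂`, `K = 𝔽₂(X)`, `O` = the `X`-adic valuation ring (rank one, residue field
`𝔽₂`), degenerate frame `n = 0`, `z = X`, `f = 0`: `span {0} = ⊥ = ker (aeval X)` because `X` is
transcendental, so every hypothesis holds, while the conclusion yields `z' ∈ O` integral over
`k[y'] = k` (empty `y'`) with `k(z') = K`, i.e. `K/k` algebraic — absurd.
Moral for provers: `f ≠ 0` is what pins `trdeg_k K = n` (it makes `z` algebraic over `k(y)`); the
corner `n = 0` of the repaired crux is vacuous (K/k algebraic ⇒ O = K ⇒ no rank one).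
No definitions, no facts; kernel-only (cdisprove seat, 2026-08-17).
-/

set_option linter.dupNamespace false

open scoped Polynomial
open IsDedekindDomain.HeightOneSpectrum

namespace Summit.ResolutionOfSingularities.ResolutionOfSingularities.Theorems

noncomputable section

section Witness

variable (F : Type) [Field F]


/-- `X ∈ F[X]_{(X)}`. [folklore] -/
theorem dfrNegA_X_mem_OX : (RatFunc.X : RatFunc F) ∈ ((Polynomial.idealX F).valuation (RatFunc F)).valuationSubring := by
  rw [Valuation.mem_valuationSubring_iff]
  change ((Polynomial.idealX F).valuation (RatFunc F)) RatFunc.X ≤ 1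
  rw [Polynomial.valuation_X_eq_neg_one, ← WithZero.exp_zero, WithZero.exp_le_exp]
  decide

/-- Polynomials lie in `F[X]_{(X)}`. [folklore] -/
theorem dfrNegA_polynomial_mem_OX (q : F[X]) : algebraMap F[X] (RatFunc F) q ∈ ((Polynomial.idealX F).valuation (RatFunc F)).valuationSubring := by
  rw [Valuation.mem_valuationSubring_iff]
  exact valuation_le_one _ _

/-- Constants lie in `F[X]_{(X)}`. [folklore] -/
theorem dfrNegA_const_mem_OX (c : F) : algebraMap F (RatFunc F) c ∈ ((Polynomial.idealX F).valuation (RatFunc F)).valuationSubring := by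
  rw [IsScalarTower.algebraMap_apply F F[X] (RatFunc F)]
  exact dfrNegA_polynomial_mem_OX F _

/-- The valuation of `OX` is equivalent to the `X`-adic valuation. [folklore] -/
theorem dfrNegA_isEquiv_OX : ((Polynomial.idealX F).valuation (RatFunc F)).IsEquiv ((Polynomial.idealX F).valuation (RatFunc F)).valuationSubring.valuation := Valuation.isEquiv_valuation_valuationSubring _

/-- `F[X]_{(X)}` has rank one. [folklore] -/
theorem dfrNegA_rankOne_OX : Nonempty ((Polynomial.idealX F).valuation (RatFunc F)).valuationSubring.valuation.RankOne := by
  haveI : ((Polynomial.idealX F).valuation (RatFunc F)).valuationSubring.valuation.IsNontrivial := by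
    refine ⟨RatFunc.X, ?_, ?_⟩
    · simp [RatFunc.X_ne_zero]
    · intro h1
      have := ((dfrNegA_isEquiv_OX F).symm.eq_one_iff_eq_one).mp h1
      simp [Polynomial.valuation_X_eq_neg_one] at this
  rw [Valuation.nonempty_rankOne_iff_mulArchimedean]
  haveI h1 : MulArchimedean (MonoidWithZeroHom.ValueGroup₀ (.ofClass ((Polynomial.idealX F).valuation (RatFunc F)))) :=
    MulArchimedean.comap MonoidWithZeroHom.ValueGroup₀.embedding.toMonoidHom
      MonoidWithZeroHom.ValueGroup₀.embedding_strictMono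
  exact MulArchimedean.comap ((dfrNegA_isEquiv_OX F).symm.orderMonoidIso).toMonoidHom
    ((dfrNegA_isEquiv_OX F).symm.orderMonoidIso).strictMono

/-- Every element of `F[X]_{(X)}` is congruent to a constant of `F` modulo the maximal ideal
(the residue field is `F`). [folklore] -/
theorem dfrNegA_exists_const_sub_lt_one (x : RatFunc F) (hx : x ∈ ((Polynomial.idealX F).valuation (RatFunc F)).valuationSubring) :
    ∃ c : F, ((Polynomial.idealX F).valuation (RatFunc F)) (x - algebraMap F (RatFunc F) c) < 1 := by
  rw [Valuation.mem_valuationSubring_iff] at hx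
  have hd : x.denom ≠ 0 := RatFunc.denom_ne_zero x
  have hd' : algebraMap F[X] (RatFunc F) x.denom ≠ 0 := RatFunc.algebraMap_ne_zero hd
  -- the denominator is not divisible by `X`
  have hd0 : x.denom.coeff 0 ≠ 0 := by
    intro h0
    have hXd : Polynomial.X ∣ x.denom := Polynomial.X_dvd_iff.mpr h0
    have hvd : (Polynomial.idealX F).intValuation x.denom < 1 :=
      (intValuation_lt_one_iff_mem _ _).mpr
        (by rw [Polynomial.idealX_span]; exact Ideal.mem_span_singleton.mpr hXd)
    have hXn : ¬ Polynomial.X ∣ x.num := by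
      intro hXn
      obtain ⟨a, b, hab⟩ := RatFunc.isCoprime_num_denom x
      have : Polynomial.X ∣ (1 : F[X]) := hab ▸ dvd_add (dvd_mul_of_dvd_right hXn a)
        (dvd_mul_of_dvd_right hXd b)
      exact Polynomial.not_isUnit_X (isUnit_of_dvd_one this)
    have hvn : (Polynomial.idealX F).intValuation x.num = 1 :=
      intValuation_eq_one_iff.mpr
        (by rw [Polynomial.idealX_span]; exact fun h => hXn (Ideal.mem_span_singleton.mp h))
    have hvx : ((Polynomial.idealX F).valuation (RatFunc F)) x = 1 / (Polynomial.idealX F).intValuation x.denom := by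
      conv_lhs => rw [← RatFunc.num_div_denom x]
      rw [map_div₀, valuation_of_algebraMap, valuation_of_algebraMap, hvn]
    have hpos : 0 < (Polynomial.idealX F).intValuation x.denom :=
      zero_lt_iff.mpr (intValuation_ne_zero _ _ hd)
    have : 1 < ((Polynomial.idealX F).valuation (RatFunc F)) x := by
      rw [hvx, one_div, one_lt_inv₀ hpos]; exact hvd
    exact absurd hx (not_le.mpr this)
  have hvd : (Polynomial.idealX F).intValuation x.denom = 1 :=
    intValuation_eq_one_iff.mpr (by
      rw [Polynomial.idealX_span]
      exact fun h => hd0 (Polynomial.X_dvd_iff.mp (Ideal.mem_span_singleton.mp h)))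
  set c : F := x.num.coeff 0 / x.denom.coeff 0 with hc
  refine ⟨c, ?_⟩
  have hx' : x - algebraMap F (RatFunc F) c =
      algebraMap F[X] (RatFunc F) (x.num - Polynomial.C c * x.denom) / algebraMap F[X] (RatFunc F) x.denom := by
    rw [map_sub, map_mul, sub_div, mul_div_assoc, div_self hd', mul_one,
      IsScalarTower.algebraMap_apply F F[X] (RatFunc F) c, Polynomial.algebraMap_eq, RatFunc.num_div_denom]
  rw [hx', map_div₀, valuation_of_algebraMap, valuation_of_algebraMap, hvd, div_one,
    intValuation_lt_one_iff_mem, Polynomial.idealX_span, Ideal.mem_span_singleton,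
    Polynomial.X_dvd_iff]
  simp [hc, div_mul_cancel₀ _ hd0]

/-- `F[X]_{(X)}` is zero-dimensional over `F`: every residue is a root of a nonzero polynomial
over `F` (namely `X - c`). [folklore] -/
theorem dfrNegA_zeroDim_OX (x : RatFunc F) (hx : x ∈ ((Polynomial.idealX F).valuation (RatFunc F)).valuationSubring) :
    ∃ g : Polynomial F, g ≠ 0 ∧ Polynomial.aeval x g ∈ ((Polynomial.idealX F).valuation (RatFunc F)).valuationSubring.nonunits := by
  obtain ⟨c, hc⟩ := dfrNegA_exists_const_sub_lt_one F x hx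
  refine ⟨Polynomial.X - Polynomial.C c, Polynomial.X_sub_C_ne_zero c, ?_⟩
  rw [ValuationSubring.mem_nonunits_iff, ← (dfrNegA_isEquiv_OX F).lt_one_iff_lt_one]
  simpa only [map_sub, Polynomial.aeval_X, Polynomial.aeval_C] using hc

/-- `F(X)` is finitely generated over `F`. [folklore] -/
theorem dfrNegA_fg_top : (⊤ : IntermediateField F (RatFunc F)).FG := ⟨{RatFunc.X}, by simp [RatFunc.adjoin_X]⟩

end Witness

/-- **`DefectlessFramesR` minus `f ≠ 0` is false** (any proof of the crux must use `f ≠ 0`):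
the statement below is the crux `DefectlessFrames.DefectlessFramesR` with the hypothesis `f ≠ 0 →`
deleted and nothing else changed; witness `k = 𝔽₂`, `K = 𝔽₂(X)`, `O` the `X`-adic ring, `n = 0`,
`z = X`, `f = 0`. [folklore] -/
theorem defectlessFramesR_false_without_f_ne_zero : ¬ (∀ p : ℕ, p.Prime → ∀ (k K : Type) [Field k] [CharP k p] [PerfectField k] [Field K] [Algebra k K], (⊤ : IntermediateField k K).FG → ∀ O : ValuationSubring K, ∀ hk : (∀ c : k, algebraMap k K c ∈ O), Nonempty O.valuation.RankOne → (∀ x ∈ O, ∃ f : Polynomial k, f ≠ 0 ∧ Polynomial.aeval x f ∈ O.nonunits) → let ρ : k →+* IsLocalRing.ResidueField O := (IsLocalRing.residue O).comp ((algebraMap k K).codRestrict O hk); let axis : (m : ℕ) → (Fin m → O) → MvPolynomial (Fin (m + 1)) k → Polynomial (IsLocalRing.ResidueField O) := fun _ w g => MvPolynomial.eval₂ (Polynomial.C.comp ρ) (Fin.snoc (fun j => Polynomial.C (IsLocalRing.residue O (w j))) Polynomial.X) g; ∀ (n : ℕ) (y : Fin n → O) (z : O) (f : MvPolynomial (Fin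 (n + 1)) k), AlgebraicIndependent k (fun i => (y i : K)) → IntermediateField.adjoin k (Set.range (fun i => (y i : K)) ∪ {(z : K)}) = ⊤ → Ideal.span {f} = RingHom.ker (MvPolynomial.aeval (Fin.snoc (fun i => (y i : K)) (z : K)) : MvPolynomial (Fin (n + 1)) k →ₐ[k] K) → ∃ (y' : Fin n → O) (z' : O) (f' : MvPolynomial (Fin (n + 1)) k), AlgebraicIndependent k (fun i => (y' i : K)) ∧ IsIntegral (Algebra.adjoin k (Set.range fun i => (y' i : K))) (z' : K) ∧ IntermediateField.adjoin k (Set.range (fun i => (y' i : K)) ∪ {(z' : K)}) = ⊤ ∧ Ideal.span {f'} = RingHom.ker (MvPolynomial.aeval (Fin.snoc (fun i => (y' i : K)) (z' : K)) : MvPolynomial (Fin (n + 1)) k →ₐ[k] K) ∧ (∀ i, (y i : K) ∈ Algebra.adjoin k (Set.range (fun i => (y' i : K)) ∪ {(z' : K)})) ∧ (z : K) ∈ Algebra.adjoin k (Set.range (fun i => (y' i : K)) ∪ {(z' : K)}) ∧ axis n y' f' ≠ 0 ∧ (axis n y f ≠ 0 → (axis n y' f').rootMultiplicity (IsLocalRing.residue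 O z') ≤ (axis n y f).rootMultiplicity (IsLocalRing.residue O z)) ∧ IsSeparable (IntermediateField.adjoin k (Set.range fun i => (y' i : K))) (z' : K) ∧ ∀ (Ω : Type) [Field Ω] [Algebra K Ω] [IsAlgClosure K Ω] (V : ValuationSubring Ω), V.comap (algebraMap K Ω) = O → let F : Subfield Ω := (IntermediateField.adjoin k (Set.range fun i => (y' i : K))).toSubfield.map (algebraMap K Ω); let Fh : Subfield Ω := (IntermediateField.lift (IntermediateField.fixedField (ValuationSubring.decompositionSubgroup F (V.comap (algebraMap (separableClosure F Ω) Ω))))).toSubfield; let T : Subfield Ω := Fh ⊔ (algebraMap K Ω).fieldRange; Fh ≤ T ∧ 0 < Subfield.relfinrank Fh T ∧ Subfield.relfinrank Fh T = (Literature.AlgebraicGeometry.Resolution.valueSubgroup Fh V).relIndex (Literature.AlgebraicGeometry.Resolution.valueSubgroup T V) * (Literature.AlgebraicGeometry.Resolution.residueSubfield Fh V).relfinrank (Literature.AlgebraicGeometry.Resolution.residueSubfield T V)) := by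
  intro h
  -- specialise the crux to the degenerate frame `n = 0`, `z = X`, `f = 0`
  have h1 := h 2 Nat.prime_two (ZMod 2) (RatFunc (ZMod 2)) (dfrNegA_fg_top _) ((Polynomial.idealX (ZMod 2)).valuation (RatFunc (ZMod 2))).valuationSubring (dfrNegA_const_mem_OX (ZMod 2))
    (dfrNegA_rankOne_OX (ZMod 2)) (dfrNegA_zeroDim_OX (ZMod 2))
  have hz : AlgebraicIndependent (ZMod 2) (fun i : Fin 0 => ((Fin.elim0 i : ((Polynomial.idealX (ZMod 2)).valuation (RatFunc (ZMod 2))).valuationSubring) : RatFunc (ZMod 2))) := by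
    rw [algebraicIndependent_empty_type_iff]
    exact (algebraMap (ZMod 2) (RatFunc (ZMod 2))).injective
  have hadj : IntermediateField.adjoin (ZMod 2)
      (Set.range (fun i : Fin 0 => ((Fin.elim0 i : ((Polynomial.idealX (ZMod 2)).valuation (RatFunc (ZMod 2))).valuationSubring) : RatFunc (ZMod 2))) ∪
        {((⟨RatFunc.X, dfrNegA_X_mem_OX (ZMod 2)⟩ : ((Polynomial.idealX (ZMod 2)).valuation (RatFunc (ZMod 2))).valuationSubring) : RatFunc (ZMod 2))}) = ⊤ := by
    simp [Set.range_eq_empty, RatFunc.adjoin_X]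
  have hker : Ideal.span {(0 : MvPolynomial (Fin (0 + 1)) (ZMod 2))} =
      RingHom.ker (MvPolynomial.aeval (Fin.snoc (fun i : Fin 0 => ((Fin.elim0 i : ((Polynomial.idealX (ZMod 2)).valuation (RatFunc (ZMod 2))).valuationSubring) : RatFunc (ZMod 2)))
        ((⟨RatFunc.X, dfrNegA_X_mem_OX (ZMod 2)⟩ : ((Polynomial.idealX (ZMod 2)).valuation (RatFunc (ZMod 2))).valuationSubring) : RatFunc (ZMod 2))) :
          MvPolynomial (Fin (0 + 1)) (ZMod 2) →ₐ[ZMod 2] RatFunc (ZMod 2)) := by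
    rw [Ideal.span_singleton_eq_bot.mpr rfl, eq_comm, ← RingHom.injective_iff_ker_eq_bot]
    haveI : Subsingleton (Fin (0 + 1)) := inferInstanceAs (Subsingleton (Fin 1))
    have hsnoc : (Fin.snoc (fun i : Fin 0 => ((Fin.elim0 i : ((Polynomial.idealX (ZMod 2)).valuation (RatFunc (ZMod 2))).valuationSubring) : RatFunc (ZMod 2)))
        ((⟨RatFunc.X, dfrNegA_X_mem_OX (ZMod 2)⟩ : ((Polynomial.idealX (ZMod 2)).valuation (RatFunc (ZMod 2))).valuationSubring) : RatFunc (ZMod 2)) : Fin (0 + 1) → RatFunc (ZMod 2)) =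
          fun _ => (RatFunc.X : RatFunc (ZMod 2)) := by
      funext i
      rw [Subsingleton.elim i (Fin.last 0), Fin.snoc_last]
    have : AlgebraicIndependent (ZMod 2) (fun _ : Fin (0 + 1) => (RatFunc.X : RatFunc (ZMod 2))) := by
      rw [algebraicIndependent_singleton_iff (0 : Fin (0 + 1))]
      exact RatFunc.transcendental_X
    rw [hsnoc]
    exact this
  obtain ⟨y', z', f', -, hint, hadj', -⟩ := h1 0 Fin.elim0 ⟨RatFunc.X, dfrNegA_X_mem_OX (ZMod 2)⟩ 0 hz hadj hker
  -- `z'` is integral over `k` (the adjoin of the empty range is `⊥`)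
  have hint' : IsIntegral (ZMod 2) (z' : RatFunc (ZMod 2)) := by
    haveI : Algebra.IsIntegral (ZMod 2)
        (Algebra.adjoin (ZMod 2) (Set.range fun i : Fin 0 => (y' i : RatFunc (ZMod 2)))) :=
      Algebra.IsIntegral.adjoin (by simp)
    exact isIntegral_trans (z' : RatFunc (ZMod 2)) hint
  have hfin : FiniteDimensional (ZMod 2) (IntermediateField.adjoin (ZMod 2) {(z' : RatFunc (ZMod 2))}) :=
    IntermediateField.adjoin.finiteDimensional hint'
  have htop : IntermediateField.adjoin (ZMod 2) {(z' : RatFunc (ZMod 2))} = ⊤ := by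
    simpa [Set.range_eq_empty] using hadj'
  have hfinK : FiniteDimensional (ZMod 2) (RatFunc (ZMod 2)) := by
    haveI : FiniteDimensional (ZMod 2) (⊤ : IntermediateField (ZMod 2) (RatFunc (ZMod 2))) := by
      rw [← htop]; exact hfin
    exact LinearEquiv.finiteDimensional
      (IntermediateField.topEquiv (F := ZMod 2) (E := RatFunc (ZMod 2))).toLinearEquiv
  have hXint : IsIntegral (ZMod 2) (RatFunc.X : RatFunc (ZMod 2)) := IsIntegral.of_finite (ZMod 2) _
  exact RatFunc.transcendental_X hXint.isAlgebraic

end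

end Summit.ResolutionOfSingularities.ResolutionOfSingularities.Theorems
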